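import Summits.NavierStokesRegularity.NavierStokesRegularity.Theorems.LerayQuarterDissipationFiniteDissipationLiouvilleDuhamelLSix
import Summits.NavierStokesRegularity.NavierStokesRegularity.Theorems.LerayQuarterDissipationFiniteDissipationLiouvilleSliceLSix
import Summits.NavierStokesRegularity.NavierStokesRegularity.Theorems.LerayQuarterDissipationFiniteDissipationLiouvilleDssReduction
import Summits.NavierStokesRegularity.NavierStokesRegularity.Theorems.LerayQuarterDissipationFiniteDissipationLiouvilleDssCorners
import Literature.Analysis.FluidPDE.ChaeWolfDSSDecayLtNine
import Literature.Analysis.UnboundedOperators.HeatKernelStrongContinuityProofs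
import HarnessLib

/-!
# Route `LerayQuarterDissipation`, crux `FiniteDissipationLiouville` (stmt-NavierStokesRegularity-22144),
  line `birth` — `L⁶` time-continuity of the stratum, the envelope bridge, and
  `stub_dssExclusion` from the wall `TypeIDSSLiouville`

`--supports stmt-NavierStokesRegularity-22144` (helper). Completes the reduction announced in
`…DssReduction.lean`: the registered stub `stub_dssExclusion` follows from the catalogued open
problem `Literature.Analysis.FluidPDE.TypeIDSSLiouville c` for all `c > 1` ALONE
(`stub_dssExclusion_of_typeIDSSLiouville`), the envelope bridge being PROVED here:

* `tendsto_eLpNorm_slice_sub` — members of the finite-dissipation stratum are continuous in time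
  with values in `L⁶(ℝ³)`: `‖w(t) − w(t₀)‖₆ → 0` as `t → t₀` within `t < 0`. Proof: with `s = t₀ − δ`,
  `w(t) − w(t₀) = (e^{(t−s)Δ} − e^{(t₀−s)Δ})w(s) − (B_s(w,w)(t) − B_s(w,w)(t₀))`; the Duhamel terms
  are `O(√δ)` in `L⁶` (`exists_eLpNorm_oseenDuhamel_six_le`, the slices being in `L⁶` by
  `memLp_six_slice`), and the caloric difference tends to `0` by the strong continuity of the heat
  semigroup on `L⁶` (tree `tendsto_heatExtension_nhdsWithin_zero_holds`) and its semigroup /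
  contraction properties.
* `exists_hasTypeIDecay_of_dss` — **the envelope bridge**: a `c`-DSS member of the stratum
  (`c > 1`) obeys a space-time Type-I envelope `‖w(t,x)‖ ≤ C₀/(‖x‖ + √(−t))`: Chae–Wolf 2017
  Thm 1.1 with `p = 6`, PROVED in the tree (`chaeWolf2017_dss_typeI_decay_of_lt_nine`), applied to
  the classical continuation of `w` (`exists_isClassicalNSSolutionOn_Iio_of_dss`).
* `stub_dssExclusion_of_typeIDSSLiouville` — hence the stub, verbatim, from
  `∀ c > 1, TypeIDSSLiouville c` (Bradshaw–Tsai 2017 Open Problem 5.1).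

So the open content of `stub_dssExclusion` is exactly the wall. Nothing here bears on
Navier–Stokes regularity; no summit is proved.
-/

noncomputable section

open Set MeasureTheory Filter Topology Function Metric Real
open Literature.Analysis Literature.Analysis.FluidPDE Literature.Analysis.UnboundedOperators
open scoped ENNReal NNReal

namespace Summit.NavierStokesRegularity.NavierStokesRegularity.Theorems.FiniteDissipationLiouville.Birth

-- the problem-side namespace duplicates `NavierStokesRegularity` by design (summit = problem)
set_option linter.dupNamespace false

/-! ### Heat flow of `L⁶` data: integrands and continuity at a positive time -/

/-- The convolution integrand of `e^{tΔ}f(x)` is integrable for `f ∈ L⁶` (Hölder against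
`G_t ∈ L^{6/5}`). -/
theorem integrable_heatKernel_smul_sub_of_memLp_six
    {f : EuclideanSpace ℝ (Fin 3) → EuclideanSpace ℝ (Fin 3)} (hf : MemLp f 6 volume)
    {t : ℝ} (ht : 0 < t) (x : EuclideanSpace ℝ (Fin 3)) :
    Integrable (fun y => heatKernel t y • f (x - y)) volume := by
  haveI : (6 : ℝ≥0∞).HolderConjugate (ENNReal.conjExponent 6) := .conjExponent (by norm_num)
  have hq : 1 ≤ ENNReal.conjExponent 6 := ENNReal.HolderConjugate.one_le (ENNReal.conjExponent 6) 6
  have h := convolutionExistsAt_of_memLp (ContinuousLinearMap.lsmul ℝ ℝ)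
    (memLp_heatKernel (E := EuclideanSpace ℝ (Fin 3)) ht hq) hf x
  simpa [ConvolutionExistsAt] using h

/-- **Continuity of the heat flow at a positive time in `L⁶`**, two-sided and uniform: for
`g ∈ L⁶`, `a > 0` and `η > 0` there is `ρ > 0` with `‖e^{τΔ}g − e^{aΔ}g‖₆ ≤ η` whenever
`|τ − a| < ρ`, `τ > 0` (semigroup law, `L⁶` contraction, strong continuity at `0`). -/
theorem exists_eLpNorm_heatExtension_sub_le
    {g : EuclideanSpace ℝ (Fin 3) → EuclideanSpace ℝ (Fin 3)} (hg : MemLp g 6 volume)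
    {a : ℝ} (ha : 0 < a) {η : ℝ≥0∞} (hη : 0 < η) :
    ∃ ρ : ℝ, 0 < ρ ∧ ∀ τ : ℝ, 0 < τ → |τ - a| < ρ →
      eLpNorm (heatExtension g τ - heatExtension g a) 6 volume ≤ η := by
  have h6 : (1 : ℝ≥0∞) ≤ 6 := by norm_num
  have h6' : (6 : ℝ≥0∞) ≠ ⊤ := by norm_num
  have hg' : MemLp (heatExtension g a) 6 volume := memLp_heatExtension_holds hg h6 ha
  -- strong continuity at `0` for `g` and for `e^{aΔ}g`
  have T := tendsto_heatExtension_nhdsWithin_zero_holds hg h6 h6'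
  have T' := tendsto_heatExtension_nhdsWithin_zero_holds hg' h6 h6'
  obtain ⟨ρ₁, hρ₁, h₁⟩ := mem_nhdsGT_iff_exists_Ioo_subset.1 ((ENNReal.tendsto_nhds_zero.1 T) η hη)
  obtain ⟨ρ₂, hρ₂, h₂⟩ := mem_nhdsGT_iff_exists_Ioo_subset.1 ((ENNReal.tendsto_nhds_zero.1 T') η hη)
  refine ⟨min ρ₁ ρ₂, lt_min hρ₁ hρ₂, fun τ hτ hτa => ?_⟩
  rcases lt_trichotomy τ a with hlt | heq | hgt
  · -- `τ < a`: `e^{aΔ}g = e^{τΔ}(e^{hΔ}g)`, `h = a − τ`, and the flow contracts `L⁶`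
    have hh : 0 < a - τ := sub_pos.2 hlt
    have hha : a - τ < ρ₁ := by
      have := (abs_lt.1 hτa).1; linarith [min_le_left ρ₁ ρ₂]
    have hsemi : heatExtension (heatExtension g (a - τ)) τ = heatExtension g a := by
      rw [heatExtension_add_holds hg h6 hh hτ, show a - τ + τ = a by ring]
    have hgh : MemLp (heatExtension g (a - τ)) 6 volume := memLp_heatExtension_holds hg h6 hh
    have hdiff : heatExtension g τ - heatExtension g a =
        heatExtension (fun y => g y - heatExtension g (a - τ) y) τ := by
      funext x
      rw [← hsemi, Pi.sub_apply]
      exact (heatExtension_sub_apply_of_integrable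
        (integrable_heatKernel_smul_sub_of_memLp_six hg hτ x)
        (integrable_heatKernel_smul_sub_of_memLp_six hgh hτ x)).symm
    rw [hdiff]
    calc eLpNorm (heatExtension (fun y => g y - heatExtension g (a - τ) y) τ) 6 volume
        ≤ eLpNorm (fun y => g y - heatExtension g (a - τ) y) 6 volume :=
          eLpNorm_heatExtension_le_holds (hg.sub hgh) h6 hτ
      _ = eLpNorm (heatExtension g (a - τ) - g) 6 volume := by
          rw [← eLpNorm_sub_comm]; rfl
      _ ≤ η := h₁ ⟨hh, hha⟩
  · subst heq; simp
  · -- `τ > a`: `e^{τΔ}g = e^{hΔ}(e^{aΔ}g)`, `h = τ − a`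
    have hh : 0 < τ - a := sub_pos.2 hgt
    have hha : τ - a < ρ₂ := by
      have := (abs_lt.1 hτa).2; linarith [min_le_right ρ₁ ρ₂]
    have hsemi : heatExtension (heatExtension g a) (τ - a) = heatExtension g τ := by
      rw [heatExtension_add_holds hg h6 ha hh, show a + (τ - a) = τ by ring]
    rw [← hsemi]
    exact h₂ ⟨hh, hha⟩

/-! ### Time-continuity of the stratum in `L⁶` -/

/-- **Members of the finite-dissipation stratum are continuous in time with values in `L⁶(ℝ³)`**
(statement and proof in the module docstring). -/
theorem tendsto_eLpNorm_slice_sub {C K : ℝ}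
    {w : ℝ → EuclideanSpace ℝ (Fin 3) → EuclideanSpace ℝ (Fin 3)} (hw : IsTypeIAncientMild C w)
    (hD : ∀ s : ℝ, s < 0 → ∫⁻ x, ‖fderiv ℝ (w s) x‖ₑ ^ 2 ≤ ENNReal.ofReal (K / Real.sqrt (-s)))
    {t₀ : ℝ} (ht₀ : t₀ < 0) :
    Tendsto (fun t => eLpNorm (w t - w t₀) 6 volume) (𝓝[Iio 0] t₀) (𝓝 0) := by
  obtain ⟨CL, hCL, hsix⟩ := memLp_six_slice
  obtain ⟨CB, hCB, hduh⟩ := exists_eLpNorm_oseenDuhamel_six_le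
  have hC0 : 0 ≤ C := hw.nonneg
  have h6 : (1 : ℝ≥0∞) ≤ 6 := by norm_num
  -- uniform bounds on `(−∞, t₁]`, `t₁ = t₀/2`
  set t₁ : ℝ := t₀ / 2 with ht₁
  have ht₁0 : t₁ < 0 := by rw [ht₁]; linarith
  have hrt₁ : 0 < Real.sqrt (-t₁) := Real.sqrt_pos.2 (by linarith)
  set A : ℝ := C / Real.sqrt (-t₁) with hA
  have hA0 : 0 ≤ A := div_nonneg hC0 hrt₁.le
  set Nr : ℝ := CL * Real.sqrt (max K 0 / Real.sqrt (-t₁)) with hNr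
  have hNr0 : 0 ≤ Nr := by rw [hNr]; positivity
  set N : ℝ≥0∞ := ENNReal.ofReal Nr with hN
  have hmem : ∀ σ < 0, MemLp (w σ) 6 volume := fun σ hσ => (hsix C K w hw hD σ hσ).1
  have hbdσ : ∀ σ, σ ≤ t₁ → ∀ y, ‖w σ y‖ ≤ A := by
    intro σ hσ y
    have hσ0 : σ < 0 := lt_of_le_of_lt hσ ht₁0
    refine (hw.norm_le hσ0 y).trans ?_
    exact div_le_div_of_nonneg_left hC0 hrt₁ (Real.sqrt_le_sqrt (by linarith))
  have hNσ : ∀ σ, σ ≤ t₁ → eLpNorm (w σ) 6 volume ≤ N := by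
    intro σ hσ
    have hσ0 : σ < 0 := lt_of_le_of_lt hσ ht₁0
    obtain ⟨hm, hb⟩ := hsix C K w hw hD σ hσ0
    rw [hm.eLpNorm_eq_integral_rpow_norm (by norm_num) (by norm_num)]
    simp only [ENNReal.toReal_ofNat, one_div] at hb ⊢
    rw [hN]
    refine ENNReal.ofReal_le_ofReal (hb.trans ?_)
    rw [hNr]
    refine mul_le_mul_of_nonneg_left (Real.sqrt_le_sqrt ?_) hCL.le
    exact div_le_div_of_nonneg_left (le_max_right _ _) hrt₁
      (Real.sqrt_le_sqrt (by linarith))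
  -- the field frozen after `t₁` (jointly measurable, same Duhamel terms up to `t₁`)
  set wc : ℝ → EuclideanSpace ℝ (Fin 3) → EuclideanSpace ℝ (Fin 3) := fun σ y => w (min σ t₁) y
    with hwc
  have hwc_eq : ∀ σ, σ ≤ t₁ → wc σ = w σ := fun σ hσ => by
    funext y; simp [hwc, min_eq_left hσ]
  have hwcm : Measurable (uncurry wc) := by
    have e : uncurry wc = uncurry w ∘ fun p : ℝ × EuclideanSpace ℝ (Fin 3) => (min p.1 t₁, p.2) := by
      funext p; rfl
    rw [e]
    refine (hw.continuousOn_uncurry.comp_continuous (by fun_prop) fun p => ?_).measurable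
    exact mk_mem_prod (lt_of_le_of_lt (min_le_right _ _) ht₁0) (mem_univ _)
  have hwcb : ∀ σ y, ‖wc σ y‖ ≤ A := fun σ y => by
    simp only [hwc]; exact hbdσ _ (min_le_right σ t₁) y
  have hwcN : ∀ σ, eLpNorm (wc σ) 6 volume ≤ N := fun σ => by
    show eLpNorm (fun y => w (min σ t₁) y) 6 volume ≤ N
    exact hNσ _ (min_le_right σ t₁)
  have hBd_wc : ∀ s t : ℝ, t ≤ t₁ → oseenDuhamel 1 s wc wc t = oseenDuhamel 1 s w w t := by
    intro s t ht
    funext x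
    rw [oseenDuhamel_apply, oseenDuhamel_apply]
    refine setIntegral_congr_fun measurableSet_Ioo fun σ hσ => ?_
    simp only [hwc_eq σ (hσ.2.le.trans ht)]
  have hBd : ∀ s t : ℝ, s < t → t ≤ t₁ →
      eLpNorm (oseenDuhamel 1 s w w t) 6 volume ≤ ENNReal.ofReal (CB * A * Real.sqrt (t - s)) * N := by
    intro s t hst ht
    rw [← hBd_wc s t ht]
    exact hduh hwcm hst (fun σ _ y => hwcb σ y) (fun σ _ => hwcN σ)
  -- ### ε–δ
  rw [ENNReal.tendsto_nhds_zero]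
  intro ε hε
  rcases eq_or_ne ε ⊤ with hεtop | hεtop
  · exact Eventually.of_forall fun t => by rw [hεtop]; exact le_top
  -- the size of the window: Duhamel terms below `ε/4`
  have hε3 : 0 < ε / 3 := ENNReal.div_pos hε.ne' (by norm_num)
  have hε3top : ε / 3 ≠ ⊤ := ENNReal.div_ne_top hεtop (by norm_num)
  set η : ℝ := (ε / 3).toReal with hη
  have hη0 : 0 < η := ENNReal.toReal_pos hε3.ne' hε3top
  set δ : ℝ := min (-t₀ / 4) ((η / (CB * A * Nr + 1)) ^ 2 / 2) with hδ
  have hδ0 : 0 < δ := lt_min (by linarith) (by positivity)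
  have hδt : δ ≤ -t₀ / 4 := min_le_left _ _
  have hδ2 : Real.sqrt (2 * δ) ≤ η / (CB * A * Nr + 1) := by
    have h2 : 2 * δ ≤ (η / (CB * A * Nr + 1)) ^ 2 := by
      have := min_le_right (-t₀ / 4) ((η / (CB * A * Nr + 1)) ^ 2 / 2); rw [← hδ] at this; linarith
    calc Real.sqrt (2 * δ) ≤ Real.sqrt ((η / (CB * A * Nr + 1)) ^ 2) := Real.sqrt_le_sqrt h2
      _ = η / (CB * A * Nr + 1) := Real.sqrt_sq (by positivity)
  have hduh_small : ∀ s t : ℝ, s < t → t ≤ t₁ → t - s ≤ 2 * δ →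
      eLpNorm (oseenDuhamel 1 s w w t) 6 volume ≤ ε / 3 := by
    intro s t hst ht hts
    refine (hBd s t hst ht).trans ?_
    rw [hN, ← ENNReal.ofReal_mul (by positivity), ← ENNReal.ofReal_toReal hε3top, ← hη]
    refine ENNReal.ofReal_le_ofReal ?_
    have hs1 : Real.sqrt (t - s) ≤ η / (CB * A * Nr + 1) :=
      (Real.sqrt_le_sqrt hts).trans hδ2
    calc CB * A * Real.sqrt (t - s) * Nr ≤ CB * A * (η / (CB * A * Nr + 1)) * Nr := by
          gcongr
      _ = η * (CB * A * Nr / (CB * A * Nr + 1)) := by ring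
      _ ≤ η * 1 := by
          refine mul_le_mul_of_nonneg_left ?_ hη0.le
          rw [div_le_one (by positivity)]; linarith
      _ = η := mul_one η
  -- the base time `s = t₀ − δ` and the caloric continuity
  set s : ℝ := t₀ - δ with hs
  have hst₀ : s < t₀ := by rw [hs]; linarith
  have hs0 : s < 0 := hst₀.trans ht₀
  have hws : MemLp (w s) 6 volume := hmem s hs0
  obtain ⟨ρ, hρ, hheat⟩ := exists_eLpNorm_heatExtension_sub_le hws (sub_pos.2 hst₀ : 0 < t₀ - s) hε3
  -- ### the eventual estimate
  have hball : {t : ℝ | |t - t₀| < min ρ δ} ∩ Iio 0 ∈ 𝓝[Iio 0] t₀ := by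
    refine inter_mem (mem_nhdsWithin_of_mem_nhds ?_) self_mem_nhdsWithin
    have : {t : ℝ | |t - t₀| < min ρ δ} = Metric.ball t₀ (min ρ δ) := by
      ext t; simp [Metric.mem_ball, Real.dist_eq]
    rw [this]
    exact Metric.ball_mem_nhds _ (lt_min hρ hδ0)
  filter_upwards [hball] with t ht
  obtain ⟨htρδ, ht0⟩ := ht
  have ht0' : t < 0 := ht0
  have htρ : |t - t₀| < ρ := lt_of_lt_of_le htρδ (min_le_left _ _)
  have htδ : |t - t₀| < δ := lt_of_lt_of_le htρδ (min_le_right _ _)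
  have hst : s < t := by rw [hs]; linarith [(abs_lt.1 htδ).1]
  have htt₁ : t ≤ t₁ := by rw [ht₁]; linarith [(abs_lt.1 htδ).2]
  have ht₀t₁ : t₀ ≤ t₁ := by rw [ht₁]; linarith
  -- the decomposition `w t − w t₀ = (H t − H t₀) − (B t − B t₀)`
  set Ht : EuclideanSpace ℝ (Fin 3) → EuclideanSpace ℝ (Fin 3) := heatExtension (w s) (t - s)
  set Ht₀ : EuclideanSpace ℝ (Fin 3) → EuclideanSpace ℝ (Fin 3) := heatExtension (w s) (t₀ - s)
  set Bt : EuclideanSpace ℝ (Fin 3) → EuclideanSpace ℝ (Fin 3) := oseenDuhamel 1 s w w t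
  set Bt₀ : EuclideanSpace ℝ (Fin 3) → EuclideanSpace ℝ (Fin 3) := oseenDuhamel 1 s w w t₀
  have hwt : w t = fun x => Ht x - Bt x := funext fun x => hw.mild_eq_heatExtension hst ht0' x
  have hwt₀ : w t₀ = fun x => Ht₀ x - Bt₀ x := funext fun x => hw.mild_eq_heatExtension hst₀ ht₀ x
  have hdec : w t - w t₀ = (Ht - Ht₀) - (Bt - Bt₀) := by
    rw [hwt, hwt₀]; funext x; simp only [Pi.sub_apply]; abel
  -- measurability of the four pieces
  have hBm : ∀ {τ : ℝ}, s < τ → τ < 0 → AEStronglyMeasurable (oseenDuhamel 1 s w w τ) volume :=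
    fun {τ} hsτ hτ0 =>
      aestronglyMeasurable_oseenDuhamel one_pos (hw.aestronglyMeasurable_uncurry (s := s) hτ0.le)
        (hw.aestronglyMeasurable_uncurry (s := s) hτ0.le)
        (div_nonneg hC0 (Real.sqrt_nonneg _))
        (fun σ hσ y => hw.norm_le_of_mem_Ioo hτ0 hσ y) (fun σ hσ y => hw.norm_le_of_mem_Ioo hτ0 hσ y)
        hsτ le_rfl
  have hHm : AEStronglyMeasurable Ht volume :=
    (memLp_heatExtension_holds hws h6 (sub_pos.2 hst)).aestronglyMeasurable
  have hHm₀ : AEStronglyMeasurable Ht₀ volume :=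
    (memLp_heatExtension_holds hws h6 (sub_pos.2 hst₀)).aestronglyMeasurable
  -- the estimate
  have hheat' : eLpNorm (Ht - Ht₀) 6 volume ≤ ε / 3 := by
    have h := hheat (t - s) (sub_pos.2 hst) (by
      rw [show t - s - (t₀ - s) = t - t₀ by ring]; exact htρ)
    exact h
  calc eLpNorm (w t - w t₀) 6 volume
      = eLpNorm ((Ht - Ht₀) - (Bt - Bt₀)) 6 volume := by rw [hdec]
    _ ≤ eLpNorm (Ht - Ht₀) 6 volume + eLpNorm (Bt - Bt₀) 6 volume :=
        eLpNorm_sub_le (hHm.sub hHm₀) ((hBm hst ht0').sub (hBm hst₀ ht₀)) h6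
    _ ≤ eLpNorm (Ht - Ht₀) 6 volume + (eLpNorm Bt 6 volume + eLpNorm Bt₀ 6 volume) := by
        gcongr
        exact eLpNorm_sub_le (hBm hst ht0') (hBm hst₀ ht₀) h6
    _ ≤ ε / 3 + (ε / 3 + ε / 3) :=
        add_le_add hheat' (add_le_add
          (hduh_small s t hst htt₁ (by rw [hs]; linarith [(abs_lt.1 htδ).2]))
          (hduh_small s t₀ hst₀ ht₀t₁ (by rw [hs]; linarith)))
    _ = ε := by rw [← add_assoc, ENNReal.add_thirds]


/-! ### The envelope bridge, and `stub_dssExclusion` from the wall -/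

/-- **The envelope bridge (Chae–Wolf 2017 Thm 1.1 with `p = 6` on the stratum).** A `c`-DSS
member of the finite-dissipation stratum (`c > 1`) obeys a space-time Type-I envelope
`‖w(t,x)‖ ≤ C₀/(‖x‖ + √(−t))` for some `C₀`: the classical continuation of `w` to `(−∞,0)`, its
`L⁶` slices (`memLp_six_slice`) and their time-continuity (`tendsto_eLpNorm_slice_sub`) are the
hypotheses of the tree's `chaeWolf2017_dss_typeI_decay_of_lt_nine`. -/
theorem exists_hasTypeIDecay_of_dss {C K c : ℝ}
    {w : ℝ → EuclideanSpace ℝ (Fin 3) → EuclideanSpace ℝ (Fin 3)} (hw : IsTypeIAncientMild C w)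
    (hD : ∀ s : ℝ, s < 0 → ∫⁻ x, ‖fderiv ℝ (w s) x‖ₑ ^ 2 ≤ ENNReal.ofReal (K / Real.sqrt (-s)))
    (hc : 1 < c) (hdss : IsDiscretelySelfSimilar c w) : ∃ C₀ : ℝ, HasTypeIDecay C₀ w := by
  obtain ⟨P, hP⟩ := exists_isClassicalNSSolutionOn_Iio_of_dss hw hc hdss
  obtain ⟨CL, -, hsix⟩ := memLp_six_slice
  have h6 : ENNReal.ofReal 6 = (6 : ℝ≥0∞) := by norm_num
  refine chaeWolf2017_dss_typeI_decay_of_lt_nine 6 (by norm_num) (by norm_num) c hc w P hP ?_ ?_ hdss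
  · intro t ht
    rw [h6]
    exact (hsix C K w hw hD t ht).1
  · intro t₀ ht₀
    simp_rw [h6]
    exact tendsto_eLpNorm_slice_sub hw hD ht₀

/-- **`stub_dssExclusion` from the wall alone.** If the catalogued Type-I `λ`-DSS Liouville
statement `Literature.Analysis.FluidPDE.TypeIDSSLiouville c` holds for every `c > 1`
(Bradshaw–Tsai 2017, Open Problem 5.1 — OPEN), then the registered stub `stub_dssExclusion` of the
crux `FiniteDissipationLiouville` holds verbatim: the envelope bridge is
`exists_hasTypeIDecay_of_dss`, the rest is `dssExclusion_of_typeIDSSLiouville`. So the open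
content of the stub is exactly the wall. -/
theorem stub_dssExclusion_of_typeIDSSLiouville
    (hwall : ∀ c : ℝ, 1 < c → TypeIDSSLiouville c) :
    ∀ (C K c : ℝ) (w : ℝ → EuclideanSpace ℝ (Fin 3) → EuclideanSpace ℝ (Fin 3)), 1 < c →
      IsTypeIAncientMild C w →
      (∀ s : ℝ, s < 0 → ∫⁻ x, ‖fderiv ℝ (w s) x‖ₑ ^ 2 ≤ ENNReal.ofReal (K / Real.sqrt (-s))) →
      IsDiscretelySelfSimilar c w →
      ¬ (∀ r > 0, ∀ M : ℝ, ∃ t ∈ Set.Ioo (-(r ^ 2)) (0 : ℝ),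
          ∃ x ∈ Metric.ball (0 : EuclideanSpace ℝ (Fin 3)) r, M < ‖w t x‖) :=
  dssExclusion_of_typeIDSSLiouville hwall fun _ _ _ _ hc hw hD hdss =>
    exists_hasTypeIDecay_of_dss hw hD hc hdss

end Summit.NavierStokesRegularity.NavierStokesRegularity.Theorems.FiniteDissipationLiouville.Birth

end
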